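import Literature.Analysis.FluidPDE.WeakGradientSlicing
import Literature.Analysis.FluidPDE.SpaceTimeMollifier
import Literature.Analysis.FunctionSpaces.LpRieszRepresentation
import HarnessLib

/-!
# Weak spatial gradients produced by duality

Analysis/FluidPDE theorem file (everything proved, [folklore]). It serves the discharge of the
named fact `Literature.Analysis.FluidPDE.HeatDivSourceGradientBound`
(`FluidPDE/SereginLocalStokesRegularity`: the `L_{3/2}` gradient estimate for very weak solutions
of the heat equation with divergence-form right-hand side, Seregin–Šverák 2009, §4 p. 11), whose
proof in the tree is a duality argument producing the a priori bound

  `|∫_Ω ∂ᵥφ ⟪u, w⟫| ≤ M ‖v‖ ‖w‖ ‖φ‖_{L^q}`   for all test functions `φ ∈ C_c^∞(Ω)`, `v, w ∈ E`,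

for a field `u ∈ L¹_loc(Ω; E)` on an open space–time region `Ω ⊆ ℝ × E` of finite measure. This
file turns such a bound into a **weak spatial gradient** in the sense of the accepted
`HasWeakSpatialGradientOn` (`FluidPDE/SuitableWeak`), lying in `L^p(Ω)` (`1/p + 1/q = 1`) with
`‖∇u‖_{L^p(Ω)} ≤ d² M`, `d = dim E` (`exists_hasWeakSpatialGradientOn_of_forall_test_le`): each
entry `Λᵢₖ(φ) = -∫_Ω ∂ₖφ uᵢ` is a functional on test functions bounded by `M ‖φ‖_{L^q}`, hence
(`Literature.Analysis.FunctionSpaces.exists_memLp_repr_of_forall_test_le`, the Riesz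
representation theorem of `FunctionSpaces/LpRieszRepresentation`) of the form `∫_Ω gᵢₖ φ` with
`‖gᵢₖ‖_{L^p(Ω)} ≤ M`; the operator field `G = Σᵢₖ gᵢₖ eᵢ ⊗ eₖ` (`rankOneSum`) is the weak gradient
(expand `v`, `w` in an orthonormal basis). This is the standard definition-chasing behind
"`∇u ∈ L_p(Q)` with the estimate" in the linear theory (e.g. Ladyzhenskaya–Solonnikov–Ural'tseva
1968, Ch. III §1; Lieberman 1996, Ch. VI), isolated as a reusable lemma.

## References

* H. Brezis, *Functional Analysis, Sobolev Spaces and PDE* (2011), Thm. 4.11 (Riesz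
  representation), Prop. 8.3/9.3 (weak derivatives by duality). [`Brezis2011`]
-/

noncomputable section

open MeasureTheory TopologicalSpace Set Function Filter Topology
open scoped ENNReal NNReal RealInnerProductSpace

namespace Literature.Analysis.FluidPDE

variable {E : Type*} [NormedAddCommGroup E] [InnerProductSpace ℝ E] [FiniteDimensional ℝ E]
  [MeasurableSpace E] [BorelSpace E]

/-! ### Operators assembled from matrix entries in an orthonormal basis -/

section RankOne

variable {ι : Type*} [Fintype ι]

omit [FiniteDimensional ℝ E] [MeasurableSpace E] [BorelSpace E] in
/-- The operator `Σᵢₖ aᵢₖ (eᵢ ⊗ eₖ) : v ↦ Σᵢ (Σₖ aᵢₖ ⟪eₖ, v⟫) eᵢ` with matrix `a` in the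
orthonormal basis `e`. [folklore] -/
def rankOneSum (b : OrthonormalBasis ι ℝ E) (a : ι → ι → ℝ) : E →L[ℝ] E :=
  ∑ i, ∑ k, a i k • (innerSL ℝ (b k)).smulRight (b i)

omit [FiniteDimensional ℝ E] [MeasurableSpace E] [BorelSpace E] in
/-- Pairings of `rankOneSum`: `⟪(Σ aᵢₖ eᵢ ⊗ eₖ) v, w⟫ = Σᵢₖ aᵢₖ ⟪eₖ, v⟫ ⟪eᵢ, w⟫`. [folklore] -/
theorem inner_rankOneSum_apply (b : OrthonormalBasis ι ℝ E) (a : ι → ι → ℝ) (v w : E) :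
    ⟪rankOneSum b a v, w⟫ = ∑ i, ∑ k, a i k * ⟪b k, v⟫ * ⟪b i, w⟫ := by
  simp only [rankOneSum, FunLike.coe_sum, Finset.sum_apply,
    FunLike.coe_smul, Pi.smul_apply, ContinuousLinearMap.smulRight_apply,
    innerSL_apply_apply, sum_inner, inner_smul_left, RCLike.conj_to_real]
  refine Finset.sum_congr rfl fun i _ => Finset.sum_congr rfl fun k _ => ?_
  ring

omit [FiniteDimensional ℝ E] [MeasurableSpace E] [BorelSpace E] in
/-- Operator-norm bound `‖Σ aᵢₖ eᵢ ⊗ eₖ‖ ≤ Σᵢₖ |aᵢₖ|`. [folklore] -/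
theorem norm_rankOneSum_le (b : OrthonormalBasis ι ℝ E) (a : ι → ι → ℝ) :
    ‖rankOneSum b a‖ ≤ ∑ i, ∑ k, |a i k| := by
  unfold rankOneSum
  refine (norm_sum_le _ _).trans (Finset.sum_le_sum fun i _ => ?_)
  refine (norm_sum_le _ _).trans (Finset.sum_le_sum fun k _ => ?_)
  rw [norm_smul, ContinuousLinearMap.norm_smulRight_apply, innerSL_apply_norm, b.norm_eq_one,
    b.norm_eq_one, mul_one, mul_one, Real.norm_eq_abs]

end RankOne

/-! ### Auxiliary measure theory -/

/-- An `L^p` function on an open set (restricted Lebesgue measure), `1 ≤ p`, is locally integrable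
on it (private copy of the tree's `locallyIntegrableOn_of_memLp_restrict` of
`FluidPDE/WeakGradientExtraction`, to keep the import closure small). [folklore] -/
private theorem locallyIntegrableOn_opens_of_memLp_restrict {F : Type*} [NormedAddCommGroup F]
    {Ω : Opens (ℝ × E)} {f : ℝ × E → F} {p : ℝ≥0∞} (hp : 1 ≤ p)
    (hf : MemLp f p (volume.restrict (Ω : Set (ℝ × E)))) :
    LocallyIntegrableOn f (Ω : Set (ℝ × E)) volume := by
  rw [locallyIntegrableOn_iff Ω.isOpen.isLocallyClosed]
  intro K hKΩ hK
  haveI : IsFiniteMeasure (volume.restrict K) := ⟨by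
    rw [Measure.restrict_apply_univ]; exact hK.measure_lt_top⟩
  have h1 : MemLp f p (volume.restrict K) := by
    have := hf.restrict K
    rwa [Measure.restrict_restrict hK.measurableSet, inter_eq_left.2 hKΩ] at this
  exact h1.integrable hp

/-- Iterated integrals of an integrable function vanishing off `S` equal its integral over `S`
(Fubini). [folklore] -/
theorem integral_integral_eq_setIntegral_of_eq_zero
    {f : ℝ × E → ℝ}
    (hf : Integrable f (volume : Measure (ℝ × E))) {S : Set (ℝ × E)} (hS : ∀ z ∉ S, f z = 0) :
    ∫ t, ∫ x, f (t, x) = ∫ z in S, f z := by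
  have h1 : ∫ z, f z ∂(volume : Measure (ℝ × E)) = ∫ t, ∫ x, f (t, x) := by
    rw [Measure.volume_eq_prod, integral_prod _ (by simpa [Measure.volume_eq_prod] using hf)]
  rw [← h1, setIntegral_eq_integral_of_forall_compl_eq_zero (fun z hz => hS z hz)]

/-! ### The theorem -/

/-- **Weak spatial gradients by duality.** Let `Ω ⊆ ℝ × E` be open of finite measure (`E` a
finite-dimensional real inner product space of dimension `d`), `u ∈ L¹_loc(Ω; E)`, `1 < p, q < ∞`
conjugate, `0 ≤ M`, and suppose that for every real test function `φ ∈ C_c^∞(Ω)` and all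
`v, w ∈ E`, `|∫_Ω ∂ᵥφ ⟪u, w⟫| ≤ M ‖v‖ ‖w‖ ‖φ‖_{L^q}`. Then `u` has a weak spatial gradient `G` on
`Ω` (`HasWeakSpatialGradientOn Ω u G`) with `G ∈ L^p(Ω)` and `‖G‖_{L^p(Ω)} ≤ d² M` (operator norms
pointwise). Proof: Riesz representation of the entries `φ ↦ -∫_Ω ∂ₖφ uᵢ` in an orthonormal basis
(`FunctionSpaces.exists_memLp_repr_of_forall_test_le`) and reassembly (`rankOneSum`). [folklore] -/
theorem exists_hasWeakSpatialGradientOn_of_forall_test_le {Ω : Opens (ℝ × E)}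
    (hΩ : volume (Ω : Set (ℝ × E)) ≠ ∞) {u : ℝ → E → E}
    (hu : LocallyIntegrableOn (uncurry u) (Ω : Set (ℝ × E)) volume)
    {p q : ℝ} (hpq : p.HolderConjugate q) {M : ℝ} (hM : 0 ≤ M)
    (hbd : ∀ φ : ℝ → E → ℝ, IsSpaceTimeTestOn Ω φ → ∀ v w : E,
      |∫ z in (Ω : Set (ℝ × E)), fderiv ℝ (φ z.1) z.2 v * ⟪u z.1 z.2, w⟫| ≤
        M * ‖v‖ * ‖w‖ * (eLpNorm (uncurry φ) (ENNReal.ofReal q) volume).toReal) :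
    ∃ G : ℝ → E → E →L[ℝ] E, HasWeakSpatialGradientOn Ω u G ∧
      MemLp (uncurry G) (ENNReal.ofReal p) (volume.restrict (Ω : Set (ℝ × E))) ∧
      eLpNorm (uncurry G) (ENNReal.ofReal p) (volume.restrict (Ω : Set (ℝ × E))) ≤
        ENNReal.ofReal ((Module.finrank ℝ E : ℝ) ^ 2 * M) := by
  set d := Module.finrank ℝ E with hd
  set b : OrthonormalBasis (Fin d) ℝ E := stdOrthonormalBasis ℝ E with hb
  have hp1 : 1 < p := hpq.lt
  have hP1 : (1 : ℝ≥0∞) ≤ ENNReal.ofReal p := by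
    rw [← ENNReal.ofReal_one]; exact ENNReal.ofReal_le_ofReal hp1.le
  set μ : Measure (ℝ × E) := volume.restrict (Ω : Set (ℝ × E)) with hμ
  haveI : IsFiniteMeasure μ := ⟨by rw [hμ, Measure.restrict_apply_univ]; exact hΩ.lt_top⟩
  haveI : (volume : Measure (ℝ × E)).IsAddHaarMeasure := Measure.prod.instIsAddHaarMeasure _ _
  -- ### the entries `Λᵢₖ φ = -∫_Ω ∂ₖφ uᵢ`
  -- slice derivatives of test functions on `Ω`
  have hslice : ∀ {φ : ℝ × E → ℝ}, FunctionSpaces.IsTestFunctionOn Ω φ → ∀ (v : E) (z : ℝ × E),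
      fderiv ℝ (fun y => φ (z.1, y)) z.2 v = fderiv ℝ φ z (0, v) := fun {φ} hφ v z =>
    fderiv_slice_apply ((hφ.contDiff.differentiable (by simp)) _) v
  have hθc : ∀ {φ : ℝ × E → ℝ}, FunctionSpaces.IsTestFunctionOn Ω φ → ∀ v : E,
      Continuous fun z : ℝ × E => fderiv ℝ (fun y => φ (z.1, y)) z.2 v := fun {φ} hφ v => by
    have : (fun z : ℝ × E => fderiv ℝ (fun y => φ (z.1, y)) z.2 v) =
        fun z => fderiv ℝ φ z (0, v) := funext fun z => hslice hφ v z
    rw [this]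
    exact (hφ.contDiff.continuous_fderiv (by simp)).clm_apply continuous_const
  have hθ0 : ∀ {φ : ℝ × E → ℝ}, FunctionSpaces.IsTestFunctionOn Ω φ → ∀ (v : E),
      ∀ z ∉ tsupport φ, fderiv ℝ (fun y => φ (z.1, y)) z.2 v = 0 := fun {φ} hφ v z hz => by
    rw [hslice hφ v z, fderiv_of_notMem_tsupport ℝ hz]
    rfl
  -- integrability of `∂ᵥφ ⟪u, w⟫` on `ℝ × E`
  have hint : ∀ {φ : ℝ × E → ℝ}, FunctionSpaces.IsTestFunctionOn Ω φ → ∀ v w : E,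
      Integrable (fun z : ℝ × E => fderiv ℝ (fun y => φ (z.1, y)) z.2 v * ⟪u z.1 z.2, w⟫)
        (volume : Measure (ℝ × E)) := fun {φ} hφ v w =>
    integrable_mul_inner_of_locallyIntegrableOn hu (hθc hφ v) hφ.hasCompactSupport
      hφ.tsupport_subset (hθ0 hφ v) w
  set Λ : Fin d → Fin d → (ℝ × E → ℝ) → ℝ := fun i k φ =>
    -∫ z in (Ω : Set (ℝ × E)), fderiv ℝ (fun y => φ (z.1, y)) z.2 (b k) * ⟪u z.1 z.2, b i⟫ with hΛ
  have hΛadd : ∀ i k (f g : ℝ × E → ℝ), FunctionSpaces.IsTestFunctionOn Ω f →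
      FunctionSpaces.IsTestFunctionOn Ω g → Λ i k (f + g) = Λ i k f + Λ i k g := by
    intro i k f g hf hg
    simp only [hΛ]
    rw [← neg_add, ← integral_add (hint hf _ _).integrableOn (hint hg _ _).integrableOn]
    congr 1
    refine setIntegral_congr_fun Ω.isOpen.measurableSet fun z _ => ?_
    have h1 : fderiv ℝ (fun y => (f + g) (z.1, y)) z.2 (b k) =
        fderiv ℝ (fun y => f (z.1, y)) z.2 (b k) + fderiv ℝ (fun y => g (z.1, y)) z.2 (b k) := by
      have hfd : DifferentiableAt ℝ (fun y => f (z.1, y)) z.2 :=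
        (contDiff_slice hf.contDiff z.1).differentiable (by simp) _
      have hgd : DifferentiableAt ℝ (fun y => g (z.1, y)) z.2 :=
        (contDiff_slice hg.contDiff z.1).differentiable (by simp) _
      have := fderiv_add hfd hgd
      simp only [Pi.add_apply]
      rw [show (fun y => f (z.1, y) + g (z.1, y)) = (fun y => f (z.1, y)) + fun y => g (z.1, y)
        from rfl, this]
      rfl
    rw [h1, add_mul]
  have hΛsmul : ∀ i k (a : ℝ) (f : ℝ × E → ℝ), FunctionSpaces.IsTestFunctionOn Ω f →
      Λ i k (a • f) = a * Λ i k f := by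
    intro i k a f hf
    simp only [hΛ]
    rw [mul_neg, ← integral_const_mul]
    congr 1
    refine setIntegral_congr_fun Ω.isOpen.measurableSet fun z _ => ?_
    have hfd : DifferentiableAt ℝ (fun y => f (z.1, y)) z.2 :=
      (contDiff_slice hf.contDiff z.1).differentiable (by simp) _
    have := fderiv_const_smul hfd a
    simp only [Pi.smul_apply, smul_eq_mul]
    rw [show (fun y => a * f (z.1, y)) = a • fun y => f (z.1, y) from rfl, this,
      FunLike.coe_smul, Pi.smul_apply, smul_eq_mul, mul_assoc]
  have hΛbd : ∀ i k (f : ℝ × E → ℝ), FunctionSpaces.IsTestFunctionOn Ω f →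
      |Λ i k f| ≤ M * (eLpNorm f (ENNReal.ofReal q) volume).toReal := by
    intro i k f hf
    have hf' : IsSpaceTimeTestOn Ω (fun t x => f (t, x)) := hf
    have h := hbd (fun t x => f (t, x)) hf' (b k) (b i)
    rw [b.norm_eq_one, b.norm_eq_one, mul_one, mul_one] at h
    simp only [hΛ, abs_neg]
    exact h
  -- ### Riesz representation of the entries
  have hrepr : ∀ i k, ∃ g : ℝ × E → ℝ, MemLp g (ENNReal.ofReal p) μ ∧
      eLpNorm g (ENNReal.ofReal p) μ ≤ ENNReal.ofReal M ∧
      ∀ f : ℝ × E → ℝ, FunctionSpaces.IsTestFunctionOn Ω f →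
        Λ i k f = ∫ z in (Ω : Set (ℝ × E)), g z * f z := fun i k =>
    FunctionSpaces.exists_memLp_repr_of_forall_test_le (μ := volume) hΩ hpq (Λ i k)
      (hΛadd i k) (hΛsmul i k) hM (hΛbd i k)
  choose g hgp' hgM hgΛ using hrepr
  have hgp : ∀ i k, MemLp (g i k) (ENNReal.ofReal p) μ := hgp'
  -- ### the operator field
  obtain ⟨L, hL⟩ : ∃ L : Fin d → Fin d → E →L[ℝ] E,
      L = fun i k => (innerSL ℝ (b k)).smulRight (b i) := ⟨_, rfl⟩
  obtain ⟨G, hG⟩ : ∃ G : ℝ → E → E →L[ℝ] E,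
      G = fun t x => rankOneSum b (fun i k => g i k (t, x)) := ⟨_, rfl⟩
  have hGz : ∀ z : ℝ × E, uncurry G z = rankOneSum b (fun i k => g i k z) := fun z => by
    rw [hG]; rfl
  have hGunc : uncurry G = fun z => ∑ i, ∑ k, g i k z • L i k := by
    funext z
    rw [hGz, hL]
    rfl
  have hGmeas : AEStronglyMeasurable (uncurry G) μ := by
    rw [hGunc]
    refine Finset.aestronglyMeasurable_fun_sum _ fun i _ => ?_
    exact Finset.aestronglyMeasurable_fun_sum _ fun k _ => (hgp i k).1.smul_const _
  have hmaj : MemLp (fun z => ∑ i, ∑ k, ‖g i k z‖) (ENNReal.ofReal p) μ := by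
    refine memLp_finsetSum _ fun i _ => ?_
    exact memLp_finsetSum _ fun k _ => (hgp i k).norm
  have hGle : ∀ z, ‖uncurry G z‖ ≤ ∑ i, ∑ k, ‖g i k z‖ := fun z => by
    rw [hGz]
    simp only [Real.norm_eq_abs]
    exact norm_rankOneSum_le b _
  have hGp : MemLp (uncurry G) (ENNReal.ofReal p) μ := by
    refine MemLp.of_le_mul (c := 1) hmaj hGmeas (Eventually.of_forall fun z => ?_)
    rw [one_mul, Real.norm_eq_abs, abs_of_nonneg (Finset.sum_nonneg fun i _ =>
      Finset.sum_nonneg fun k _ => norm_nonneg _)]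
    exact hGle z
  have hGli : LocallyIntegrableOn (uncurry G) (Ω : Set (ℝ × E)) volume :=
    locallyIntegrableOn_opens_of_memLp_restrict hP1 hGp
  have hGnorm : eLpNorm (uncurry G) (ENNReal.ofReal p) μ ≤ ENNReal.ofReal ((d : ℝ) ^ 2 * M) := by
    have h1 : eLpNorm (uncurry G) (ENNReal.ofReal p) μ ≤
        eLpNorm (fun z => ∑ i, ∑ k, ‖g i k z‖) (ENNReal.ofReal p) μ :=
      eLpNorm_mono_real hGle
    have h2 : eLpNorm (fun z => ∑ i, ∑ k, ‖g i k z‖) (ENNReal.ofReal p) μ ≤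
        ∑ i, ∑ k, eLpNorm (g i k) (ENNReal.ofReal p) μ := by
      have e1 : (fun z => ∑ i, ∑ k, ‖g i k z‖) = ∑ i, fun z => ∑ k, ‖g i k z‖ := by
        funext z; simp only [Finset.sum_apply]
      rw [e1]
      have hmk : ∀ i k, AEStronglyMeasurable (fun z => ‖g i k z‖) μ := fun i k => (hgp i k).1.norm
      have hmi : ∀ i, AEStronglyMeasurable (fun z => ∑ k, ‖g i k z‖) μ := fun i =>
        Finset.aestronglyMeasurable_fun_sum _ fun k _ => hmk i k
      refine (eLpNorm_sum_le (fun i _ => hmi i) hP1).trans (Finset.sum_le_sum fun i _ => ?_)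
      have e2 : (fun z => ∑ k, ‖g i k z‖) = ∑ k, fun z => ‖g i k z‖ := by
        funext z; simp only [Finset.sum_apply]
      rw [e2]
      refine (eLpNorm_sum_le (fun k _ => hmk i k) hP1).trans (Finset.sum_le_sum fun k _ => ?_)
      exact (eLpNorm_norm (g i k)).le
    have h3 : ∑ i : Fin d, ∑ k : Fin d, eLpNorm (g i k) (ENNReal.ofReal p) μ ≤
        ∑ _i : Fin d, ∑ _k : Fin d, ENNReal.ofReal M :=
      Finset.sum_le_sum fun i _ => Finset.sum_le_sum fun k _ => hgM i k
    refine h1.trans (h2.trans (h3.trans ?_))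
    rw [Finset.sum_const, Finset.sum_const, Finset.card_univ, Fintype.card_fin, nsmul_eq_mul,
      nsmul_eq_mul, ← mul_assoc, ENNReal.ofReal_mul (by positivity), ENNReal.ofReal_pow
      (Nat.cast_nonneg _), ENNReal.ofReal_natCast, sq]
  refine ⟨G, ⟨hu, hGli, fun φ hφ v w => ?_⟩, hGp, hGnorm⟩
  -- ### the integration-by-parts identity
  have hφ' : FunctionSpaces.IsTestFunctionOn Ω (uncurry φ) := hφ
  set K : Set (ℝ × E) := tsupport (uncurry φ) with hK
  have hKc : IsCompact K := hφ.hasCompactSupport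
  have hKΩ : K ⊆ (Ω : Set (ℝ × E)) := hφ.tsupport_subset
  have cφ : Continuous (uncurry φ) := hφ.contDiff.continuous
  have hφK : ∀ z ∉ K, φ z.1 z.2 = 0 := fun z hz =>
    show uncurry φ z = 0 from image_eq_zero_of_notMem_tsupport hz
  obtain ⟨Cφ, hCφ⟩ := cφ.bounded_above_of_compact_support hKc
  -- slice derivatives of the curried field are those of the uncurried one
  have eθ : ∀ (v : E) (z : ℝ × E), fderiv ℝ (φ z.1) z.2 v =
      fderiv ℝ (fun y => uncurry φ (z.1, y)) z.2 v := fun v z => rfl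
  -- left-hand side as a set integral, expanded in the basis
  have hL1 : ∫ t, ∫ x, fderiv ℝ (φ t) x v * ⟪u t x, w⟫ =
      ∫ z in (Ω : Set (ℝ × E)), fderiv ℝ (φ z.1) z.2 v * ⟪u z.1 z.2, w⟫ :=
    integral_integral_eq_setIntegral_of_eq_zero (f := fun z => fderiv ℝ (φ z.1) z.2 v * ⟪u z.1 z.2, w⟫)
      (hint hφ' v w) fun z hz => by rw [eθ, hθ0 hφ' v z (fun h => hz (hKΩ h)), zero_mul]
  have hL2 : ∫ z in (Ω : Set (ℝ × E)), fderiv ℝ (φ z.1) z.2 v * ⟪u z.1 z.2, w⟫ =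
      ∑ i, ∑ k, ⟪b k, v⟫ * ⟪b i, w⟫ *
        ∫ z in (Ω : Set (ℝ × E)), fderiv ℝ (φ z.1) z.2 (b k) * ⟪u z.1 z.2, b i⟫ := by
    have e1 : ∀ z : ℝ × E, fderiv ℝ (φ z.1) z.2 v * ⟪u z.1 z.2, w⟫ =
        ∑ i, ∑ k, ⟪b k, v⟫ * ⟪b i, w⟫ * (fderiv ℝ (φ z.1) z.2 (b k) * ⟪u z.1 z.2, b i⟫) := by
      intro z
      have hv : fderiv ℝ (φ z.1) z.2 v = ∑ k, ⟪b k, v⟫ * fderiv ℝ (φ z.1) z.2 (b k) := by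
        conv_lhs => rw [← b.sum_repr' v]
        rw [map_sum]
        refine Finset.sum_congr rfl fun k _ => ?_
        rw [map_smul, smul_eq_mul]
      have hw : ⟪u z.1 z.2, w⟫ = ∑ i, ⟪u z.1 z.2, b i⟫ * ⟪b i, w⟫ :=
        (b.sum_inner_mul_inner (u z.1 z.2) w).symm
      rw [hv, hw, Finset.sum_mul, Finset.sum_comm]
      refine Finset.sum_congr rfl fun i _ => ?_
      rw [Finset.mul_sum]
      refine Finset.sum_congr rfl fun k _ => ?_
      ring
    simp_rw [e1]
    rw [integral_finsetSum _ fun i _ => ?_]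
    · refine Finset.sum_congr rfl fun i _ => ?_
      rw [integral_finsetSum _ fun k _ => ?_]
      · refine Finset.sum_congr rfl fun k _ => ?_
        rw [integral_const_mul]
      · exact ((hint hφ' (b k) (b i)).const_mul _).integrableOn
    · exact integrable_finsetSum _ fun k _ => ((hint hφ' (b k) (b i)).const_mul _).integrableOn
  -- right-hand side as a set integral, expanded through the entries
  have hgint : ∀ i k, Integrable (fun z => g i k z * uncurry φ z) μ := fun i k =>
    ((hgp i k).integrable hP1).mul_bdd cφ.aestronglyMeasurable (Eventually.of_forall hCφ)
  have hR1 : ∫ t, ∫ x, φ t x * ⟪G t x v, w⟫ =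
      ∫ z in (Ω : Set (ℝ × E)), φ z.1 z.2 * ⟪G z.1 z.2 v, w⟫ :=
    integral_integral_eq_setIntegral_of_eq_zero (f := fun z => φ z.1 z.2 * ⟪G z.1 z.2 v, w⟫)
      (integrable_mul_inner_apply_of_locallyIntegrableOn hGli cφ hKc hKΩ hφK v w)
      fun z hz => by rw [hφK z (fun h => hz (hKΩ h)), zero_mul]
  have hR2 : ∫ z in (Ω : Set (ℝ × E)), φ z.1 z.2 * ⟪G z.1 z.2 v, w⟫ =
      ∑ i, ∑ k, ⟪b k, v⟫ * ⟪b i, w⟫ * ∫ z in (Ω : Set (ℝ × E)), g i k z * uncurry φ z := by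
    have e1 : ∀ z : ℝ × E, φ z.1 z.2 * ⟪G z.1 z.2 v, w⟫ =
        ∑ i, ∑ k, ⟪b k, v⟫ * ⟪b i, w⟫ * (g i k z * uncurry φ z) := by
      intro z
      have hGz' : G z.1 z.2 = rankOneSum b (fun i k => g i k z) := hGz z
      rw [hGz', inner_rankOneSum_apply, Finset.mul_sum]
      refine Finset.sum_congr rfl fun i _ => ?_
      rw [Finset.mul_sum]
      refine Finset.sum_congr rfl fun k _ => ?_
      simp only [uncurry]
      ring
    simp_rw [e1]
    rw [integral_finsetSum _ fun i _ => ?_]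
    · refine Finset.sum_congr rfl fun i _ => ?_
      rw [integral_finsetSum _ fun k _ => ?_]
      · refine Finset.sum_congr rfl fun k _ => ?_
        rw [integral_const_mul]
      · exact (hgint i k).const_mul _
    · exact integrable_finsetSum _ fun k _ => (hgint i k).const_mul _
  -- the entries: `∫_Ω gᵢₖ φ = Λᵢₖ φ = -∫_Ω ∂ₖφ uᵢ`
  have hentry : ∀ i k, ∫ z in (Ω : Set (ℝ × E)), g i k z * uncurry φ z =
      -∫ z in (Ω : Set (ℝ × E)), fderiv ℝ (φ z.1) z.2 (b k) * ⟪u z.1 z.2, b i⟫ := fun i k => by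
    rw [← hgΛ i k (uncurry φ) hφ']
    rfl
  rw [hL1, hL2, hR1, hR2, ← Finset.sum_neg_distrib]
  refine Finset.sum_congr rfl fun i _ => ?_
  rw [← Finset.sum_neg_distrib]
  refine Finset.sum_congr rfl fun k _ => ?_
  rw [hentry, mul_neg, neg_neg]

end Literature.Analysis.FluidPDE

end
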